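import Summits.AtomisticToContinuum.FouriersLaw.Theorems.EmbeddedDrudeMourreGreenKuboContinuationCanonicalSpectralMeasure
import Summits.AtomisticToContinuum.FouriersLaw.Theorems.HoelderEscapeProfileAbelSpreadCeilingCanonicalTwin
import Literature.MathematicalPhysics.KineticTheory.InfiniteChainShiftInvariantUniqueness
import HarnessLib

/-!
# Stub `stub_spectralRepresentation` of line `SpikeLemma`, crux `CoercivePulse.LinearCeiling`
(item stmt-AtomisticToContinuum-15383; `--supports` file, closes nothing; line lead, 2026-08-17)

WHAT. Registered stub 3 of the skeleton `Cruxes/LinearCeiling/Lines/SpikeLemma.lean`: for the pinned anharmonic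
chain `pinnedChain ω₂ lam β γ` (`ω₂, lam, β > 0`), EVERY guarded pair — a shift- and momentum-reversal-invariant
DLR state `μ` at `T > 0` and ANY `μ`-preserving infinite-volume dynamics `D` — has a cosine-Bochner spectral
measure: a finite measure `σ` on `ℝ` with `C_T(t) = D.currentCorrelation μ t = ∫ cos(ωt) dσ(ω)` for all `t`.

HOW (pure assembly of landed theorems).
(a) `GreenKuboContinuation.BandLimitedKrylov.stub_canonicalSpectralMeasure` at bath constant `1` (it needs the
    bath constant `> 0`; the infinite-volume objects `U`, `V`, `bmGood`, `IsChainGibbsMeasure`, `bondCurrentZ`,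
    `IsSolution`, `currentCorrelation` do not see `γ`, the identifications are definitional): ONE dynamics `Dfw`
    with carrier `bmGood` and, at `T`, a shift-invariant preserved DLR state `μfw` with
    `Dfw.currentCorrelation μfw t = ∫ cos(ωt) dσ` for a finite `σ`.
(b) Uniqueness of the shift-invariant DLR state of the pinned chain
    (`OscillatorChain.eq_of_isChainGibbsMeasure_of_isShiftInvariant_pinnedChain`): `μ = μfw`.
(c) The canonical twin `D'` of `D` (`AbelSpreadCeiling.RegularityCollapse.stub_canonicalTwin`): carrier `bmGood`,
    preserves `μ`, same `C_T`; transported verbatim to bath constant `1` as `D₁` (same carrier and flow).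
(d) Two dynamics with the same carrier `bmGood` have the same flow on `bmGood` (the `unique` field of
    `InfiniteChainDynamics`); `μ`-a.e. configuration lies in `bmGood`, so `D₁.flow t =ᵐ[μ] Dfw.flow t` and
    `currentCorrelation_congr_ae` gives `D₁.currentCorrelation μ = Dfw.currentCorrelation μ`.
Chain: `D.C_T = D'.C_T = D₁.C_T (rfl) = Dfw.C_T(μ) = Dfw.C_T(μfw) = ∫ cos dσ`.
-/

noncomputable section

namespace Summit.AtomisticToContinuum.FouriersLaw.Theorems.LinearCeiling.SpikeLemma

open MeasureTheory Filter Set Function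
open scoped Topology BigOperators
open Literature.MathematicalPhysics.KineticTheory.HeatConduction

/-- **Two dynamics with nested carriers agree a.e. under any measure carried by the smaller carrier.**
If `D₁.carrier ⊆ D₂.carrier` and `μ`-a.e. configuration lies in `D₁.carrier`, then `D₁.flow t =ᵐ[μ] D₂.flow t`
for every `t` (the `D₁`-orbit of a carrier point stays in `D₁.carrier ⊆ D₂.carrier` and solves the equations of
motion, so by the `unique` field of `D₂` it is the `D₂`-orbit). [folklore] -/
theorem flow_ae_eq_of_carrier_subset {P : OscillatorChain} (D₁ D₂ : InfiniteChainDynamics P)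
    (hsub : D₁.carrier ⊆ D₂.carrier) {μ : Measure ChainConfig} (hμ : ∀ᵐ σ ∂μ, σ ∈ D₁.carrier) (t : ℝ) :
    D₁.flow t =ᵐ[μ] D₂.flow t := by
  filter_upwards [hμ] with σ hσ
  have hu := D₂.unique (fun s => D₁.flow s σ) (fun s => hsub (D₁.flow_mem hσ s)) (D₁.isSolution σ hσ) t
  -- `hu : D₁.flow t σ = D₂.flow t (D₁.flow 0 σ)`
  rw [D₁.flow_zero σ hσ] at hu
  exact hu

/-- **Stub `stub_spectralRepresentation` (registered signature, verbatim).** For the pinned anharmonic chain,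
every guarded pair `(μ, D)` (shift- and reversal-invariant DLR state `μ` at `T > 0`, `μ`-preserving dynamics `D`)
admits a finite spectral measure `σ` on `ℝ` with `D.currentCorrelation μ t = ∫ cos(ωt) dσ(ω)` for all `t`: the
cosine-Bochner representation of the summed current autocorrelation `C_T` entering the Green–Kubo formula, transferred
from the canonical Buttà–Marchioro pair through DLR uniqueness and uniqueness of good orbits.
[cite: BonettoLebowitzReyBellet2000, §7] -/
theorem stub_spectralRepresentation :
    ∀ ω₂ lam β γ : ℝ, 0 < ω₂ → 0 < lam → 0 < β → ∀ T : ℝ, 0 < T → ∀ μ : MeasureTheory.Measure Literature.MathematicalPhysics.KineticTheory.HeatConduction.ChainConfig, (Literature.MathematicalPhysics.KineticTheory.HeatConduction.pinnedChain ω₂ lam β γ).IsChainGibbsMeasure T μ → Literature.MathematicalPhysics.KineticTheory.HeatConduction.IsShiftInvariant μ → μ.map (fun σ : Literature.MathematicalPhysics.KineticTheory.HeatConduction.ChainConfig => fun x : ℤ => ((σ x).1, -(σ x).2)) = μ → ∀ D : Literature.MathematicalPhysics.KineticTheory.HeatConduction.InfiniteChainDynamics (Literature.MathematicalPhysics.KineticTheory.HeatConduction.pinnedChain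 ω₂ lam β γ), D.PreservesMeasure μ → ∃ σ : MeasureTheory.Measure ℝ, MeasureTheory.IsFiniteMeasure σ ∧ ∀ t : ℝ, D.currentCorrelation μ t = ∫ ω, Real.cos (ω * t) ∂σ := by
  intro ω₂ lam β γ hω hl hβ T hT μ hG hSI hR D hP
  -- (a) the canonical pair and its spectral measure at bath constant `1`
  obtain ⟨Dfw, hDfwcar, hfam⟩ :=
    Summit.AtomisticToContinuum.FouriersLaw.Theorems.GreenKuboContinuation.BandLimitedKrylov.stub_canonicalSpectralMeasure
      ω₂ lam β 1 hω hl hβ one_pos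
  obtain ⟨μfw, σ, hGfw, hSIfw, -, -, hσfin, -, hcos⟩ := hfam T hT
  -- (b) uniqueness of the shift-invariant DLR state: `μ = μfw`
  have hG₁ : (pinnedChain ω₂ lam β 1).IsChainGibbsMeasure T μ := hG
  have hμ : μ = μfw :=
    OscillatorChain.eq_of_isChainGibbsMeasure_of_isShiftInvariant_pinnedChain 1 hω hl.le hβ.le hT hG₁ hSI
      hGfw hSIfw
  -- (c) the canonical twin of `D`, transported to bath constant `1`
  obtain ⟨D', hcar, -, -, hP', -, -, hCC⟩ :=
    Summit.AtomisticToContinuum.FouriersLaw.Theorems.AbelSpreadCeiling.RegularityCollapse.stub_canonicalTwin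
      ω₂ lam β γ hω hl hβ T hT μ hG hSI hR D hP
  let D₁ : InfiniteChainDynamics (pinnedChain ω₂ lam β 1) :=
    ⟨D'.carrier, D'.flow, D'.mapsTo, D'.flow_zero, D'.isSolution, D'.unique⟩
  have hcc₁ : ∀ t : ℝ, D₁.currentCorrelation μ t = D'.currentCorrelation μ t := fun _ => rfl
  -- (d) same carrier `bmGood` ⇒ same flow `μ`-a.e. ⇒ same `C_T`
  have hsub : D₁.carrier ⊆ Dfw.carrier := by
    rw [hDfwcar]
    exact subset_of_eq hcar
  have hae : ∀ t : ℝ, D₁.flow t =ᵐ[μ] Dfw.flow t :=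
    flow_ae_eq_of_carrier_subset D₁ Dfw hsub hP'.1
  have hC : ∀ t : ℝ, D.currentCorrelation μ t = Dfw.currentCorrelation μ t := fun t => by
    rw [← hCC t, ← hcc₁ t]
    exact
      Summit.AtomisticToContinuum.FouriersLaw.Theorems.AbelSpreadCeiling.RegularityCollapse.currentCorrelation_congr_ae
        D₁ Dfw μ hae t
  refine ⟨σ, hσfin, fun t => ?_⟩
  rw [hC t, hμ]
  exact hcos t

end Summit.AtomisticToContinuum.FouriersLaw.Theorems.LinearCeiling.SpikeLemma

end
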